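import Mathlib
import Summits.ResolutionOfSingularities.ResolutionOfSingularities.Theorems.WeightedInvariantLocalWeightedDropPolyDescentSelDefs
import Summits.ResolutionOfSingularities.ResolutionOfSingularities.Theorems.WeightedInvariantLocalWeightedDropPolyDescentPrepExists

/-!
# `LocalWeightedDrop`, TOT2-LINE inner S-ASM (9): THE SELECTOR HYPOTHESIS `hsel` OF THE (P)/(L) ASSEMBLIES, DISCHARGED for the lazy selector
# `prepSelWP`

Crux item stmt-ResolutionOfSingularities-8899 `WeightedInvariant.LocalWeightedDrop` (route `ResolutionOfSingularities/WeightedInvariant`), ENGINE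
skeleton v34 (80c4710965b6845c), registered stubs `stub_regimePresented` (P) / `stub_regimeLetter` (L).  [OURS · L1 W4.3 · chain w43 · seat
res-L1-w43-lead-1 gen 5; def-free; on res-L1-w43-stub-2's `PolyDescent.isPrepRecentring_prepSelWP` / `isPrepRecentring_zero` (…PolyDescentSelDefs) and
the landed (ρ-P) `PolyDescent.stub_polyPrep` (…PolyDescentPrepExists).  Nothing here is a statement of any manuscript; AI-produced, gate-checked,
weaker than expert review.]

* `PolyDescent.wellPrepared_of_eq_zero` — a label of degree `0` is well-prepared (its Newton set is empty);
* **`PolyDescent.isPrepRecentring_prepSelWP_of_isPosT`** — for EVERY `d`, the lazy selector prepares every position: the hypothesis `hsel` of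
  `TameFourTupleDrop.regimePresented_of_pieces` / `regimePresented_of_pieces₂` / `regimeLetter_of_pieces` with `ψsel := prepSelWP`;
* `TameFourTupleDrop.hsel_holds` — the same under the stubs' binders.
-/

set_option linter.dupNamespace false -- mandated namespace of this single-conjunct summit

noncomputable section

namespace Summit.ResolutionOfSingularities.ResolutionOfSingularities.Theorems

namespace PolyDescent

open MvPowerSeries

variable {k : Type} [Field k]

/-- A label of degree `0` is well-prepared: its Newton set is empty. -/
theorem wellPrepared_of_eq_zero (X : Fin 0 → MvPowerSeries (Fin 2) k) : WellPrepared 0 X := by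
  intro P hP
  obtain ⟨j, -⟩ := hP.1
  exact j.elim0

/-- **THE LAZY SELECTOR PREPARES EVERY POSITION** (every `d`). -/
theorem isPrepRecentring_prepSelWP_of_isPosT (d : ℕ) (X : Fin d → MvPowerSeries (Fin 2) k) (hpos : IsPosT d X) :
    IsPrepRecentring d X (prepSelWP d X) := by
  rcases Nat.eq_zero_or_pos d with rfl | hd
  · have hWP := wellPrepared_of_eq_zero X
    rw [prepSelWP_of_wellPrepared hWP]
    exact isPrepRecentring_zero hpos hWP
  · exact isPrepRecentring_prepSelWP (stub_polyPrep k d hd) hpos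

end PolyDescent

namespace TameFourTupleDrop

/-- **`hsel` UNDER THE STUBS' BINDERS** with `ψsel := fun k d => prepSelWP d`. -/
theorem hsel_holds : ∀ (p : ℕ), p.Prime → ∀ (k : Type) [Field k] [CharP k p] [IsAlgClosed k],
    ∀ (d : ℕ) (X : Fin d → MvPowerSeries (Fin 2) k), PolyDescent.IsPosT d X → PolyDescent.IsPrepRecentring d X (PolyDescent.prepSelWP d X) :=
  fun _ _ _ _ _ _ d X hpos => PolyDescent.isPrepRecentring_prepSelWP_of_isPosT d X hpos

end TameFourTupleDrop

end Summit.ResolutionOfSingularities.ResolutionOfSingularities.Theorems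

end
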